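import Mathlib
import HarnessLib

/-!
# SlowSmoothMinorant

Topic `Literature/Uncategorized`. Named literature fact(s) relocated by the gate from `Summits/FinalStateConjecture/FinalStateConjecture/Theorems/StarvedNecksNeckGapDecayStubSlowSmoothMinorant.lean`
(accept-time relocation of `[cite]`d propositions written inline in a Summits proposal; human ruling 2026-08-15).

* `Literature.Uncategorized.SlowSmoothMinorant`
-/

namespace Literature.Uncategorized

open Filter Set Topology
open scoped ContDiff

/-- **W4 — slow smooth minorant** (real-variable lemma placing a receding seam radius below a
growing certified radius).  For every monotone `g : ℝ → ℝ` with `g → +∞` and every floor `b` there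
is a `C^∞`, non-decreasing `ϱ → +∞` with `b ≤ ϱ`, with `ϱ + 6 ≤ g` from some threshold `T` on, and
SLOW: `|ϱ′|, |ϱ″|, |ϱ‴| ≤ 1` on `ℝ` (a staircase `b + ∑ₙ H((u - Tₙ)/L)` of widely spaced, slowly
climbed smooth unit steps `H = Real.smoothTransition`, the `n`-th step starting only once
`g ≥ b + n + 8`). [folklore] -/
def SlowSmoothMinorant : Prop :=
  ∀ (g : ℝ → ℝ) (b : ℝ), Monotone g → Tendsto g atTop atTop →
    ∃ ϱ : ℝ → ℝ, ContDiff ℝ ∞ ϱ ∧ Monotone ϱ ∧ Tendsto ϱ atTop atTop ∧ (∀ u, b ≤ ϱ u) ∧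
      (∃ T : ℝ, ∀ u, T ≤ u → ϱ u + 6 ≤ g u) ∧
      (∀ u, |deriv ϱ u| ≤ 1) ∧ (∀ u, |iteratedDeriv 2 ϱ u| ≤ 1) ∧ (∀ u, |iteratedDeriv 3 ϱ u| ≤ 1)

/-! ### The smooth unit step `H = Real.smoothTransition`: derivatives -/

end Literature.Uncategorized
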